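import Mathlib.Tactic.Ring
import Literature.Dynamics.Tilings.WangTilesReindex
import Literature.Barriers.AtomisticToContinuum.AperiodicTilingGroundStatesProofs
import HarnessLib

/-!
# Aperiodic Wang tile sets exist (Berger 1966; here via Kari 1996) — in the tile-set vocabulary
# of `Literature/Dynamics/Tilings`

Berger's theorem — "`τ` tiles the plane, but no periodic tiling exists. We will say that `τ` is
aperiodic", and such tile sets exist [Jeandel–Vanier 2020, §1.2, Theorem 2 (Berger)] — is
proved in the tree in the barrier catalogue of `AtomisticToContinuum`
(`Literature.Barriers.AtomisticToContinuum.WangLatticeGas.Berger1966_aperiodicTileset_holds`,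
from the Kari-type tile set of [Jeandel–Vanier 2020, §5.3; Kari 1996]) in that file's own
vocabulary: `WangTile C` (a structure), tile sets `τ : Finset (WangTile C)`, cartesian
configurations `x : ℤ × ℤ → τ` (`IsTiling`: east neighbour `(a + 1, b)`, north neighbour
`(a, b + 1)`) and `IsPeriodic` (`p`-periodic in both directions, `p ≥ 1`). This file is the
DICTIONARY between that vocabulary and `Literature.Dynamics.Tilings.WangTileSet`
(matrix convention, tori) and transfers the theorem:

* `WangTileSet.ofFinset τ : WangTileSet τ C` — a finite set of tiles as a tile family;
* `isTiling_iff_isPlaneTiling` — `x` is a tiling iff `f i j := x (j, -i)` is a plane tiling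
  (row `i` = ordinate `-i`, column `j` = abscissa `j`);
* `isAperiodic_ofFinset_iff` — `(ofFinset τ).IsAperiodic` iff `τ` tiles the plane and no
  tiling by `τ` is periodic (the catalogue's / Jeandel–Vanier's formulation), via
  `tilesTorus_iff_exists_periodic`;
* `isAperiodic_kari` — the Kari-type tile set is aperiodic; `exists_isAperiodic` (some finite
  tile set over a finite colour set is aperiodic) and `exists_isAperiodic_ofNESW` (some colour
  table `τ : Fin t → ℕ × ℕ × ℕ × ℕ` is aperiodic — non-vacuity of the hypothesis class of the
  items of route PneNP/AperiodicTorus).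

Import direction: this file imports the barrier catalogue (where the construction currently
lives); `WangTiles.lean` itself does not, so the catalogue can later be rebased on it and the
construction moved here by a librarian without an import cycle.

## References

* E. Jeandel, P. Vanier, *The undecidability of the Domino Problem*, LNM 2273 (2020): §1.1
  Definitions 1–2, §1.2 (Theorem 2, Berger), §5.3 Lemmas 4–5.
* R. Berger, *The undecidability of the domino problem*, Mem. AMS 66 (1966).
* J. Kari, *A small aperiodic set of Wang tiles*, Discrete Math. 160 (1996) 259–264,
  Propositions 1–2.
-/

namespace Literature.Dynamics.Tilings

namespace WangTileSet

open Literature.Barriers.AtomisticToContinuum.WangLatticeGas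

variable {C : Type}

/-! ### Finite sets of tiles as tile families -/

/-- The tile set of a finite set `τ` of Wang tiles of the catalogue (`WangTile C`: a structure
`north south east west : C`): tiles indexed by `τ` itself. [cite: JeandelVanier2020, §1.1 Definition 1] -/
def ofFinset (τ : Finset (WangTile C)) : WangTileSet τ C where
  north s := s.1.north
  east s := s.1.east
  south s := s.1.south
  west s := s.1.west

/-- **Dictionary, tilings.** A cartesian configuration `x : ℤ² → τ` is a tiling (east
neighbour `(a + 1, b)`, north neighbour `(a, b + 1)`) iff the matrix configuration
`f i j := x (j, -i)` is a plane tiling of `ofFinset τ` (rows increase southward).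
[cite: JeandelVanier2020, §1.1 Definition 2] -/
theorem isTiling_iff_isPlaneTiling {τ : Finset (WangTile C)} (x : ℤ × ℤ → τ) :
    IsTiling x ↔ (ofFinset τ).IsPlaneTiling fun i j => x (j, -i) := by
  constructor
  · intro h i j
    refine ⟨(h j (-i)).1, ?_⟩
    have h2 := (h j (-(i + 1))).2
    rw [show -(i + 1) + 1 = -i by ring] at h2
    exact h2.symm
  · intro h a b
    refine ⟨?_, ?_⟩
    · have h1 : (ofFinset τ).east (x (a, -(-b))) = (ofFinset τ).west (x (a + 1, -(-b))) :=
        (h (-b) a).1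
      rw [neg_neg] at h1
      exact h1
    · have h2 : (ofFinset τ).south (x (a, -(-(b + 1)))) =
          (ofFinset τ).north (x (a, -(-(b + 1) + 1))) :=
        (h (-(b + 1)) a).2
      rw [neg_neg, show -(-(b + 1) + 1) = b by ring] at h2
      exact h2.symm

/-- The matrix configuration `f` read in cartesian coordinates, `x (a, b) := f (-b) a`, is a
tiling iff `f` is a plane tiling. [cite: JeandelVanier2020, §1.1 Definition 2] -/
theorem isTiling_uncurry_iff {τ : Finset (WangTile C)} (f : ℤ → ℤ → τ) :
    IsTiling (fun q : ℤ × ℤ => f (-q.2) q.1) ↔ (ofFinset τ).IsPlaneTiling f := by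
  rw [isTiling_iff_isPlaneTiling]
  simp only [neg_neg]

/-- **Dictionary, tiles the plane.** [cite: JeandelVanier2020, §1.1 Definition 2] -/
theorem tilesPlane_ofFinset_iff (τ : Finset (WangTile C)) :
    (ofFinset τ).TilesPlane ↔ ∃ x : ℤ × ℤ → τ, IsTiling x :=
  ⟨fun ⟨f, hf⟩ => ⟨_, (isTiling_uncurry_iff f).2 hf⟩,
    fun ⟨x, hx⟩ => ⟨_, (isTiling_iff_isPlaneTiling x).1 hx⟩⟩

/-- **Dictionary, periodic tilings.** `τ` admits a periodic tiling (some `p ≥ 1` with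
`x (a + p, b) = x (a, b) = x (a, b + p)`) iff `ofFinset τ` tiles some torus `(ℤ/n)²`, `n ≥ 1`.
[cite: JeandelVanier2020, §1.2] -/
theorem exists_isPeriodic_iff (τ : Finset (WangTile C)) :
    (∃ x : ℤ × ℤ → τ, IsTiling x ∧ IsPeriodic x) ↔ ∃ n ≥ 1, (ofFinset τ).TilesTorus n := by
  constructor
  · rintro ⟨x, hx, p, hp, hper⟩
    obtain ⟨n, rfl⟩ : ∃ n : ℕ, p = n := ⟨p.toNat, (Int.toNat_of_nonneg hp.le).symm⟩
    have hn : 1 ≤ n := by omega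
    refine ⟨n, hn, tilesTorus_of_periodic ((isTiling_iff_isPlaneTiling x).1 hx)
      fun i j => ⟨?_, ?_⟩⟩
    · show x (j, -(i + n)) = x (j, -i)
      have h := (hper j (-i - n)).2
      rw [show -i - (n : ℤ) + n = -i by ring] at h
      rw [show -(i + (n : ℤ)) = -i - n by ring, h]
    · show x (j + n, -i) = x (j, -i)
      exact (hper j (-i)).1
  · rintro ⟨n, hn, hT⟩
    obtain ⟨f, hf, hper⟩ := hT.exists_periodic hn
    have hn' : (0 : ℤ) < n := by exact_mod_cast hn
    refine ⟨fun q => f (-q.2) q.1, (isTiling_uncurry_iff f).2 hf, n, hn', fun a b => ⟨?_, ?_⟩⟩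
    · show f (-b) (a + n) = f (-b) a
      exact (hper (-b) a).2
    · show f (-(b + n)) a = f (-b) a
      have h := (hper (-(b + n)) a).1
      rw [show -(b + (n : ℤ)) + n = -b by ring] at h
      exact h.symm

/-- **Dictionary, aperiodicity.** `ofFinset τ` is aperiodic (`TilesPlane ∧ ∀ n ≥ 1,
¬ TilesTorus n`) iff `τ` tiles the plane and no tiling by `τ` is periodic — the formulation of
the catalogue's `Berger1966_aperiodicTileset` and of Jeandel–Vanier.
[cite: JeandelVanier2020, §1.2] -/
theorem isAperiodic_ofFinset_iff (τ : Finset (WangTile C)) :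
    (ofFinset τ).IsAperiodic ↔
      (∃ x : ℤ × ℤ → τ, IsTiling x) ∧ ∀ x : ℤ × ℤ → τ, IsTiling x → ¬ IsPeriodic x := by
  unfold IsAperiodic
  rw [tilesPlane_ofFinset_iff]
  refine and_congr_right fun _ => ?_
  constructor
  · intro h x hx hp
    obtain ⟨n, hn, hT⟩ := (exists_isPeriodic_iff τ).1 ⟨x, hx, hp⟩
    exact h n hn hT
  · intro h n hn hT
    obtain ⟨x, hx, hp⟩ := (exists_isPeriodic_iff τ).2 ⟨n, hn, hT⟩
    exact h x hx hp

/-! ### Existence of aperiodic tile sets -/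

/-- **The Kari-type tile set is aperiodic** (in the vocabulary of `WangTileSet`): the tile set
`Kari.tileset` of Jeandel–Vanier §5.3 (all transitions of the transducers multiplying balanced
representations by `2` and by `2/3`) tiles the plane and no torus.
[cite: JeandelVanier2020, §5.3 Lemmas 4–5] [cite: Kari1996, Propositions 1–2] -/
theorem isAperiodic_kari : (ofFinset Kari.tileset).IsAperiodic :=
  (isAperiodic_ofFinset_iff _).2 ⟨⟨Kari.tiling, Kari.isTiling_tiling⟩, fun _ hx => Kari.not_isPeriodic hx⟩

/-- **Berger's theorem**: there is a finite set of Wang tiles over a finite colour set that is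
aperiodic — it tiles the plane but no torus `(ℤ/n)²`, `n ≥ 1` (equivalently, admits no periodic
tiling). [cite: JeandelVanier2020, §1.2 Theorem 2] -/
theorem exists_isAperiodic :
    ∃ (C : Type) (_ : Fintype C) (τ : Finset (WangTile C)), (ofFinset τ).IsAperiodic :=
  ⟨Kari.Col, inferInstance, Kari.tileset, isAperiodic_kari⟩

/-- The catalogue's named fact, read through the dictionary: any witness of
`Berger1966_aperiodicTileset` is an aperiodic `WangTileSet`. [cite: JeandelVanier2020, §1.2 Theorem 2] -/
theorem exists_isAperiodic_of_berger (h : Berger1966_aperiodicTileset) :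
    ∃ (C : Type) (_ : Fintype C) (τ : Finset (WangTile C)), (ofFinset τ).IsAperiodic := by
  obtain ⟨C, hC, τ, hτ⟩ := h
  exact ⟨C, hC, τ, (isAperiodic_ofFinset_iff τ).2 hτ⟩

/-- **Berger's theorem for colour tables**: some `τ : Fin t → ℕ × ℕ × ℕ × ℕ` is aperiodic —
the hypothesis class "a finite Wang tile set that tiles the plane but no `n × n` torus" of the
items of route PneNP/AperiodicTorus is non-empty. [cite: JeandelVanier2020, §1.2 Theorem 2] -/
theorem exists_isAperiodic_ofNESW :
    ∃ (t : ℕ) (τ : Fin t → ℕ × ℕ × ℕ × ℕ), (ofNESW τ).IsAperiodic :=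
  isAperiodic_kari.exists_ofNESW

end WangTileSet

end Literature.Dynamics.Tilings
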